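import Literature.AlgebraicGeometry.Morphisms.GraphFamilyBaseChange
import Literature.AlgebraicGeometry.Morphisms.HomSchemePieceOfLayersFiniteType
import HarnessLib

/-!
# Points of a Hom-scheme piece: the base change of the universal morphism along `w : T → M` and ITS LETTERS

Topic `Literature/AlgebraicGeometry/Morphisms`; namespace `Literature.AlgebraicGeometry.Morphisms`.  THEOREMS ONLY (no definition, no named fact, no
instance, no notation, no `sorry`).  Cell `hodgecm-mathlib` (D-0151), P6 «MOD programme» (crux hLiu418 = stmt-HodgeConjecture-24832), line-candidate
`F0_P6a_IsomSchemeFiniteType`, sub-organ **(Id)** of `stub_ICON` (A-p14 (g34) census `CENSUS-ICON-IsomConditionsLocus.v1` §2; A-p13 (g37)'s (O-A)): the ONLY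
pull-back bookkeeping the `Isom`-pieces need.  HC_CM is proved only modulo the 2 remaining named inputs (hLiu418, h413) until rung 0 closes; generic,
count-neutral.

## The mathematics

A Hom-scheme datum for `(q : Y → S, p : X → S)` is `(M, m : M → S, u : Y ×_S M → X ×_S M)` with `u` over `M` ([MumfordFogartyKirwan1994] Ch. 0 §5 (c); the
★ piece `Morphisms.exists_homSchemePiece_of_layers_quasiCompact` is one, with SELF = «the graph family of `u` over `M` has the letters `Q`»).  For
`w : T → M` with `w ≫ m = t`:

* §1 **`exists_restrict_of_piece`** — the BASE CHANGE `u_w : Y ×_S T → X ×_S T` of `u` along `w`, as a `T`-morphism CLASSIFIED by `w`: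
  `u_w ≫ (X-comparison along w) = (Y-comparison along w) ≫ u` (Mathlib `pullback.map`; explicit `pullback.lift`, no pasting isomorphism), and
  `eq_of_classified` — a `T`-morphism is determined by this identity (cf. ★ `HomSchemeYoneda.eq_of_classifiedBy`).
* §2 **`graphLetters_of_classified`** — «THE LETTERS DESCEND ALONG THE CLASSIFICATION»: if the graph family of `u` over `M` has the letters `Q` at every
  field point of `M` (the SELF clause, stated UNFOLDED = the cell's `GraphLetters q p jW m u Q`), then the graph family of any `φ` over `T` classified by
  `w` has the letters `Q` at every field point of `T` (UNFOLDED = `GraphLetters q p jW t φ Q`): the graph of the base change is the base change of the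
  graph (★ `isPullback_map_graphFamily`, cartesian over `𝐏(w)`) and both letters pass along cartesian squares of embedded families (★
  `letters_of_isPullback_projectiveSpaceMap`; [Hartshorne1977] III Thm. 9.9, [EGAIII2] 7.9.11).
* §3 **`floor_eval_eq_of_graphLetters`** — letters at ONE field point force ADMISSIBILITY of `Q`: `⌊Q(e)⌋₊ = Q(e)` for `e ≥ B(Q) − 1` (the rank letter
  says `Q(e)` is a dimension); so a non-admissible `Q` is the letter of no morphism over a scheme with a field point.

## References
* [MumfordFogartyKirwan1994] D. Mumford, J. Fogarty, F. Kirwan, *Geometric Invariant Theory*, 3rd ed. (1994), Ch. 0 §5 (c) (p. 23).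
* [Hartshorne1977] R. Hartshorne, *Algebraic Geometry* (1977), III Thm. 9.9 (p. 261).
* [EGAIII2] A. Grothendieck, *EGA III₂* (Publ. Math. IHÉS 17, 1963), 7.9.11.
* [GortzWedhorn2020] U. Görtz, T. Wedhorn, *Algebraic Geometry I*, 2nd ed. (2020), Section (4.7), Definition 9.7.
-/

set_option autoImplicit false

noncomputable section

-- Mathlib's pull-back API is stated across semireducible wrappers.
set_option backward.isDefEq.respectTransparency false

open CategoryTheory CategoryTheory.Limits CategoryTheory.Abelian AlgebraicGeometry Polynomial
open Literature.AlgebraicGeometry.Modules Literature.AlgebraicGeometry.Modules.SerreTwist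
open Literature.Algebra.Homology Literature.Algebra.Homology.LaurentCech Literature.Algebra.Homology.OrderedCech

namespace Literature.AlgebraicGeometry.Morphisms

section Restrict

variable {S Y X M T : Scheme.{0}} (q : Y ⟶ S) (p : X ⟶ S) (m : M ⟶ S) (u : pullback q m ⟶ pullback p m)
  (hu : u ≫ pullback.snd p m = pullback.snd q m) (w : T ⟶ M) (t : T ⟶ S) (hw : w ≫ m = t)

/-! ### §1 The base change of the universal morphism along `w : T → M`, classified by `w` -/

include hu in
/-- **The base change `u_w` of `u` along `w`, classified by `w`.**  For `w ≫ m = t` there is a `T`-morphism `φ : Y ×_S T → X ×_S T`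
(`φ ≫ pr_T = pr_T`) with `φ ≫ (X-comparison along w) = (Y-comparison along w) ≫ u` — explicitly `φ = ((Y-comparison) ≫ u ≫ pr_X, pr_T)`.
[cite: MumfordFogartyKirwan1994, Ch. 0 §5 (c) (p. 23)] [cite: GortzWedhorn2020, Section (4.7)] -/
theorem exists_restrict_of_piece :
    ∃ φ : pullback q t ⟶ pullback p t, φ ≫ pullback.snd p t = pullback.snd q t ∧
      φ ≫ pullback.map p t p m (𝟙 X) w (𝟙 S) (by simp) (by simpa using hw.symm) =
        pullback.map q t q m (𝟙 Y) w (𝟙 S) (by simp) (by simpa using hw.symm) ≫ u := by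
  have hcond : (pullback.map q t q m (𝟙 Y) w (𝟙 S) (by simp) (by simpa using hw.symm) ≫ u ≫ pullback.fst p m) ≫ p =
      pullback.snd q t ≫ t := by
    rw [Category.assoc, Category.assoc, pullback.condition, reassoc_of% hu, pullback.lift_snd_assoc, Category.assoc, hw]
  refine ⟨pullback.lift _ _ hcond, pullback.lift_snd _ _ _, ?_⟩
  apply pullback.hom_ext
  · simp only [Category.assoc, pullback.lift_fst, Category.comp_id]
  · simp only [Category.assoc, pullback.lift_snd, pullback.lift_snd_assoc, hu]

/-- **A `T`-morphism is determined by its classification identity along `w`** (its `X`-component is read off `u`, its `T`-component is `pr_T`).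
[cite: MumfordFogartyKirwan1994, Ch. 0 §5 (c) (p. 23)] -/
theorem eq_of_classified (φ φ' : pullback q t ⟶ pullback p t) (hφ : φ ≫ pullback.snd p t = pullback.snd q t)
    (hφ' : φ' ≫ pullback.snd p t = pullback.snd q t)
    (h : φ ≫ pullback.map p t p m (𝟙 X) w (𝟙 S) (by simp) (by simpa using hw.symm) =
      pullback.map q t q m (𝟙 Y) w (𝟙 S) (by simp) (by simpa using hw.symm) ≫ u)
    (h' : φ' ≫ pullback.map p t p m (𝟙 X) w (𝟙 S) (by simp) (by simpa using hw.symm) =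
      pullback.map q t q m (𝟙 Y) w (𝟙 S) (by simp) (by simpa using hw.symm) ≫ u) : φ = φ' := by
  apply pullback.hom_ext
  · have e := congrArg (· ≫ pullback.fst p m) h
    have e' := congrArg (· ≫ pullback.fst p m) h'
    simp only [Category.assoc, pullback.lift_fst, Category.comp_id] at e e'
    rw [e, e']
  · rw [hφ, hφ']

end Restrict

/-! ### §2 The letters descend along the classification -/

section Letters

variable {S Y X M T : Scheme.{0}} (q : Y ⟶ S) (p : X ⟶ S) {ι : Type} (jW : pullback q p ⟶ Morphisms.projectiveSpace ι S)
  (hjW : jW ≫ Morphisms.projectiveSpaceFst ι S = pullback.fst q p ≫ q)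
  (m : M ⟶ S) (u : pullback q m ⟶ pullback p m) (hu : u ≫ pullback.snd p m = pullback.snd q m) (Q : ℚ[X])

include hjW hu in
/-- **THE LETTERS DESCEND ALONG THE CLASSIFICATION.**  If the graph family of `u` over `M` has the letters `Q` at every field point of `M` (SELF of
the Hom-scheme piece — the cell's `GraphLetters q p jW m u Q`, UNFOLDED), `w ≫ m = t`, and the `T`-morphism `φ` is classified by `w`
(`φ ≫ (X-comparison) = (Y-comparison) ≫ u`), then the graph family of `φ` over `T` has the letters `Q` at every field point of `T` (the cell's
`GraphLetters q p jW t φ Q`, UNFOLDED).  The graph of the base change is the base change of the graph (★ `isPullback_map_graphFamily`) and both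
letters of cohomology-and-base-change pass along that cartesian square (★ `letters_of_isPullback_projectiveSpaceMap`).
[cite: Hartshorne1977, III Thm. 9.9 (p. 261)] [cite: EGAIII2, 7.9.11] [cite: MumfordFogartyKirwan1994, Ch. 0 §5 (c) (p. 23)] -/
theorem graphLetters_of_classified
    (hself : ∀ (hw : pullback.fst q m ≫ q = (u ≫ pullback.fst p m) ≫ p) (iΓ : pullback q m ⟶ Morphisms.projectiveSpace ι M),
      iΓ ≫ Morphisms.projectiveSpaceFst ι M = pullback.snd q m →
      iΓ ≫ Morphisms.projectiveSpaceMap ι m = pullback.lift (pullback.fst q m) (u ≫ pullback.fst p m) hw ≫ jW →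
      ∀ ⦃K : Type⦄ [Field K] ⦃X' : Scheme.{0}⦄ (k : X' ⟶ pullback q m) (f₀ : X' ⟶ Spec (CommRingCat.of K))
        (x : Spec (CommRingCat.of K) ⟶ M), IsPullback k f₀ (iΓ ≫ Morphisms.projectiveSpaceFst ι M) x →
        ∀ e : ℕ, regularityBound (preHilbertPoly ℚ (Nat.card ι) 0) 0 (preHilbertPoly ℚ (Nat.card ι) 0 - Q) - 1 ≤ (e : ℤ) →
          Subsingleton (CategoryTheory.Abelian.Ext.{1} (unitModule X') ((Scheme.Modules.pullback k).obj
            (twistMod (iΓ ≫ pullback.snd (terminal.from M) (terminal.from (Morphisms.projectiveSpaceInt ι))) (unitModule _) e)) 1) ∧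
          ((Module.finrank Γ(Spec (CommRingCat.of K), ⊤) (SecMod ((Scheme.Modules.pullback k).obj
            (twistMod (iΓ ≫ pullback.snd (terminal.from M) (terminal.from (Morphisms.projectiveSpaceInt ι))) (unitModule _) e))
            f₀.appTop.hom ⊤) : ℕ) : ℚ) = Q.eval (e : ℚ))
    {T : Scheme.{0}} (w : T ⟶ M) (t : T ⟶ S) (hw : w ≫ m = t) (φ : pullback q t ⟶ pullback p t)
    (hcl : φ ≫ pullback.map p t p m (𝟙 X) w (𝟙 S) (by simp) (by simpa using hw.symm) =
      pullback.map q t q m (𝟙 Y) w (𝟙 S) (by simp) (by simpa using hw.symm) ≫ u) :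
    ∀ (hw' : pullback.fst q t ≫ q = (φ ≫ pullback.fst p t) ≫ p) (iΓ' : pullback q t ⟶ Morphisms.projectiveSpace ι T),
      iΓ' ≫ Morphisms.projectiveSpaceFst ι T = pullback.snd q t →
      iΓ' ≫ Morphisms.projectiveSpaceMap ι t = pullback.lift (pullback.fst q t) (φ ≫ pullback.fst p t) hw' ≫ jW →
      ∀ ⦃K : Type⦄ [Field K] ⦃X' : Scheme.{0}⦄ (k : X' ⟶ pullback q t) (f₀ : X' ⟶ Spec (CommRingCat.of K))
        (x : Spec (CommRingCat.of K) ⟶ T), IsPullback k f₀ (iΓ' ≫ Morphisms.projectiveSpaceFst ι T) x →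
        ∀ e : ℕ, regularityBound (preHilbertPoly ℚ (Nat.card ι) 0) 0 (preHilbertPoly ℚ (Nat.card ι) 0 - Q) - 1 ≤ (e : ℤ) →
          Subsingleton (CategoryTheory.Abelian.Ext.{1} (unitModule X') ((Scheme.Modules.pullback k).obj
            (twistMod (iΓ' ≫ pullback.snd (terminal.from T) (terminal.from (Morphisms.projectiveSpaceInt ι))) (unitModule _) e)) 1) ∧
          ((Module.finrank Γ(Spec (CommRingCat.of K), ⊤) (SecMod ((Scheme.Modules.pullback k).obj
            (twistMod (iΓ' ≫ pullback.snd (terminal.from T) (terminal.from (Morphisms.projectiveSpaceInt ι))) (unitModule _) e))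
            f₀.appTop.hom ⊤) : ℕ) : ℚ) = Q.eval (e : ℚ) := by
  intro hw' iΓ' h₁' h₂' K _ X' k f₀ x H' e he
  -- a graph family of `u` over `M`
  have hwM : pullback.fst q m ≫ q = (u ≫ pullback.fst p m) ≫ p := fst_comp_eq_comp_fst_comp_of_over q p m u hu
  obtain ⟨iΓ, h₁, h₂⟩ := exists_graphFamily_of_over q p jW m u hjW hwM
  -- the graph of the base change is the base change of the graph: a cartesian square over `𝐏(w)`
  have Hsq := isPullback_map_graphFamily q p jW m u hwM iΓ h₁ h₂ w t hw φ hw' hcl iΓ' h₁' h₂'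
  -- both letters pass along it
  exact letters_of_isPullback_projectiveSpaceMap iΓ w (pullback.map q t q m (𝟙 Y) w (𝟙 S) (by simp) (by simpa using hw.symm)) iΓ'
    Hsq k f₀ x H' e (Q.eval (e : ℚ)) fun k₀ H₀ => hself hwM iΓ h₁ h₂ k₀ f₀ (x ≫ w) H₀ e he

end Letters

/-! ### §3 Letters at one field point force admissibility -/

section Admissible

variable {S Y X T : Scheme.{0}} (q : Y ⟶ S) (p : X ⟶ S) {ι : Type} (jW : pullback q p ⟶ Morphisms.projectiveSpace ι S)
  (hjW : jW ≫ Morphisms.projectiveSpaceFst ι S = pullback.fst q p ≫ q)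
  (t : T ⟶ S) (φ : pullback q t ⟶ pullback p t) (hφ : φ ≫ pullback.snd p t = pullback.snd q t) (Q : ℚ[X])

include hjW hφ in
/-- **Letters at one field point force admissibility of the letter.**  If the graph family of `φ` over `T` has the letters `Q` (the cell's
`GraphLetters q p jW t φ Q`, UNFOLDED) and `T` has a field point `x : Spec K → T`, then `⌊Q(e)⌋₊ = Q(e)` for every `e ≥ B(Q) − 1`: the rank letter at
the square `(pr_{Y_T} restricted, …)` — here the canonical square of the fibre `Y_T ×_T Spec K` — exhibits `Q(e)` as a dimension.  (Used
contrapositively: a non-admissible `Q` is the graph letter of no morphism, so its `Isom`-piece may be taken EMPTY.)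
[cite: MumfordFogartyKirwan1994, Ch. 0 §5 (c) (p. 23)] [cite: Hartshorne1977, III Thm. 9.9 (p. 261)] -/
theorem floor_eval_eq_of_graphLetters
    (hlet : ∀ (hw : pullback.fst q t ≫ q = (φ ≫ pullback.fst p t) ≫ p) (iΓ : pullback q t ⟶ Morphisms.projectiveSpace ι T),
      iΓ ≫ Morphisms.projectiveSpaceFst ι T = pullback.snd q t →
      iΓ ≫ Morphisms.projectiveSpaceMap ι t = pullback.lift (pullback.fst q t) (φ ≫ pullback.fst p t) hw ≫ jW →
      ∀ ⦃K : Type⦄ [Field K] ⦃X' : Scheme.{0}⦄ (k : X' ⟶ pullback q t) (f₀ : X' ⟶ Spec (CommRingCat.of K))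
        (x : Spec (CommRingCat.of K) ⟶ T), IsPullback k f₀ (iΓ ≫ Morphisms.projectiveSpaceFst ι T) x →
        ∀ e : ℕ, regularityBound (preHilbertPoly ℚ (Nat.card ι) 0) 0 (preHilbertPoly ℚ (Nat.card ι) 0 - Q) - 1 ≤ (e : ℤ) →
          Subsingleton (CategoryTheory.Abelian.Ext.{1} (unitModule X') ((Scheme.Modules.pullback k).obj
            (twistMod (iΓ ≫ pullback.snd (terminal.from T) (terminal.from (Morphisms.projectiveSpaceInt ι))) (unitModule _) e)) 1) ∧
          ((Module.finrank Γ(Spec (CommRingCat.of K), ⊤) (SecMod ((Scheme.Modules.pullback k).obj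
            (twistMod (iΓ ≫ pullback.snd (terminal.from T) (terminal.from (Morphisms.projectiveSpaceInt ι))) (unitModule _) e))
            f₀.appTop.hom ⊤) : ℕ) : ℚ) = Q.eval (e : ℚ))
    {K : Type} [Field K] (x : Spec (CommRingCat.of K) ⟶ T) :
    ∀ e : ℕ, regularityBound (preHilbertPoly ℚ (Nat.card ι) 0) 0 (preHilbertPoly ℚ (Nat.card ι) 0 - Q) - 1 ≤ (e : ℤ) →
      ((⌊Q.eval (e : ℚ)⌋₊ : ℕ) : ℚ) = Q.eval (e : ℚ) := by
  intro e he
  have hw : pullback.fst q t ≫ q = (φ ≫ pullback.fst p t) ≫ p := fst_comp_eq_comp_fst_comp_of_over q p t φ hφ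
  obtain ⟨iΓ, h₁, h₂⟩ := exists_graphFamily_of_over q p jW t φ hjW hw
  -- the fibre of `Y_T → T` over the field point `x`
  have H : IsPullback (pullback.fst (iΓ ≫ Morphisms.projectiveSpaceFst ι T) x) (pullback.snd (iΓ ≫ Morphisms.projectiveSpaceFst ι T) x)
      (iΓ ≫ Morphisms.projectiveSpaceFst ι T) x := IsPullback.of_hasPullback _ _
  obtain ⟨-, hrk⟩ := hlet hw iΓ h₁ h₂ (pullback.fst _ _) (pullback.snd _ _) x H e he
  rw [← hrk, Nat.floor_natCast]

end Admissible

end Literature.AlgebraicGeometry.Morphisms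

end
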